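/-
Route lead rlead-rh-ScrewPolyaSigns g0, 2026-08-30.  LADDER-RH bookkeeping (route ScrewPolyaSigns, D-0179
split-or-blocker check): the KERNEL CERTIFICATE that the route's one open residual is the summit in costume.
Nothing in this file bears on the truth of RH.
-/
import Summits.RiemannHypothesis.RiemannHypothesis.Theorems.ScrewPolyaSignsAssemblyR
import Summits.RiemannHypothesis.RiemannHypothesis.Theorems.ScrewPolyaSignsPolyaLandauR
import Summits.RiemannHypothesis.RiemannHypothesis.Theorems.ScrewPolyaSignsScrewSignSparseGlue
import HarnessLib

/-!
# Route `ScrewPolyaSigns`: the residual `ScrewSignSparse` [24182] is RH-EQUIVALENT (kernel) — blocker certificate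

D-0179 SPLIT-OR-BLOCKER check of route `route-RiemannHypothesis-ScrewPolyaSigns` (rev 5,
`closes (h₁ : PolyaLandauR) (h₂ : ScrewSignSparse) (hA : AssemblyR) : Summit.RiemannHypothesis := hA h₁ h₂`).
Both RH-free binders are tree theorems (`polyaLandauR_proof` [24464], `ScrewPolyaSignsAssemblyR.assemblyR`
[24465]), so the deciding theorem is a kernel map `ScrewSignSparse → RH`; conversely RH gives `Ψ = zetaScrew ≥ 0`
(`ZetaScrewThm17.zetaScrew_nonneg_of_RH`, Suzuki2023 Thm 1.7), so NO strictly sign-alternating pair of values of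
`Ψ` exists and `ScrewSignSparse` holds with `D = B = 0`.  Hence

* `riemannHypothesis_iff_screwSignSparse : Summit.RiemannHypothesis ↔ ScrewSignSparse` — the open residual
  [24182] IS the summit (COSTUME by degeneracy of the sign-change coordinates under RH: `Ψ ≥ 0` leaves no
  alternating pair, so `D = B = 0`);
* `riemannHypothesis_iff_screwSignSparseKV_of_census : KinkValleyCensus → (RH ↔ ScrewSignSparseKV)` — the gen-1
  child [24907] is RH-implied outright (`screwSignSparseKV_of_riemannHypothesis`) and becomes kernel-RH-equivalent
  exactly when the RH-free census [24906] lands (through the proved glue [24908]); so [24906] changes the FORM of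
  the residual, never its strength;
* the superseded rev-0 bridge [24183] `Assembly : PolyaLandau → ScrewSignSparse → RH` is provable EX FALSO from
  the landed refutation `ScrewPolyaSignsRefutation.not_PolyaLandau` of [24181]; it is mathematically void and is NOT
  restated here (the gate keeps it as a record item).

DEGENERACY LEMMA behind the verdict (informal, for the blocker node BLOCKER-24182.md): every statement about the
sign changes of `Ψ` that is vacuous when `Ψ ≥ 0` is RH-implied; if it also forces the alternating-chain density
below `10⁵/π` it implies RH through [24464]+[24465]; so no re-decomposition of [24182] INSIDE the sign-change
coordinates can produce a piece strictly weaker than RH that carries difficulty.  HONEST LABEL: harvested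
(b)-criterion «RH ⟺ the sign changes of Ψ have upper density < 10⁵/π»; 0 summit credit; RH is not proved.
-/

-- D-0017: `Summit.RiemannHypothesis.RiemannHypothesis.…` duplicates the namespace BY DESIGN (single-problem summit).
set_option linter.dupNamespace false

noncomputable section

open Literature.NumberTheory.LFunctions

namespace Summit.RiemannHypothesis.RiemannHypothesis.Theorems.ScrewPolyaSignsResidualIff

open Summit.RiemannHypothesis.RiemannHypothesis.Theses.ScrewPolyaSigns

/-- Under RH, `Ψ ≥ 0` everywhere, so no two values of `Ψ` have strictly negative product. -/
theorem not_alternating_of_riemannHypothesis (hRH : Summit.RiemannHypothesis) (a b : ℝ) :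
    ¬ zetaScrew a * zetaScrew b < 0 :=
  not_lt.2 (mul_nonneg (ZetaScrewThm17.zetaScrew_nonneg_of_RH (Summit.RiemannHypothesis_iff.1 hRH) a)
    (ZetaScrewThm17.zetaScrew_nonneg_of_RH (Summit.RiemannHypothesis_iff.1 hRH) b))

/-- **RH ⟹ `ScrewSignSparse` [24182]** with `D = B = 0`: under RH a strictly sign-alternating chain of `Ψ`
has length `0`.  The residual is RH-implied (standard axioms only). -/
theorem screwSignSparse_of_riemannHypothesis : Summit.RiemannHypothesis → ScrewSignSparse := by
  intro hRH
  refine ⟨0, 0, by norm_num, ?_⟩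
  intro T _ n t _ _ halt
  cases n with
  | zero => simp
  | succ k => exact absurd (halt ⟨0, by omega⟩) (not_alternating_of_riemannHypothesis hRH _ _)

/-- **`ScrewSignSparse` [24182] ⟹ RH**: the route's deciding theorem with its two proved binders
(`polyaLandauR_proof` [24464], `ScrewPolyaSignsAssemblyR.assemblyR` [24465]) instantiated (computational lane:
the `10⁵` strip certificate inside `assemblyR`). -/
theorem riemannHypothesis_of_screwSignSparse : ScrewSignSparse → Summit.RiemannHypothesis :=
  ScrewPolyaSignsAssemblyR.assemblyR polyaLandauR_proof

/-- **BLOCKER CERTIFICATE: `RH ↔ ScrewSignSparse` [24182].**  The one open residual of route `ScrewPolyaSigns`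
is the summit in costume (kernel; standard axioms + the computational lane inherited from `assemblyR`). -/
theorem riemannHypothesis_iff_screwSignSparse : Summit.RiemannHypothesis ↔ ScrewSignSparse :=
  ⟨screwSignSparse_of_riemannHypothesis, riemannHypothesis_of_screwSignSparse⟩

/-- **RH ⟹ `ScrewSignSparseKV` [24907]** with `D = B = 0` (the kink/valley side conditions are not used):
the gen-1 child is RH-implied outright. -/
theorem screwSignSparseKV_of_riemannHypothesis : Summit.RiemannHypothesis → ScrewSignSparseKV := by
  intro hRH
  refine ⟨0, 0, by norm_num, ?_⟩
  intro T _ n t _ _ halt _ _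
  cases n with
  | zero => simp
  | succ k => exact absurd (halt ⟨0, by omega⟩) (not_alternating_of_riemannHypothesis hRH _ _)

/-- The child [24907] is formally WEAKER than the parent [24182]: `ScrewSignSparse → ScrewSignSparseKV`
(kink–valley chains are special chains); the only missing arrow `ScrewSignSparseKV → ScrewSignSparse` is the
proved glue's use of the RH-free census [24906]. -/
theorem screwSignSparseKV_of_screwSignSparse : ScrewSignSparse → ScrewSignSparseKV := by
  rintro ⟨D, B, hD, h⟩
  exact ⟨D, B, hD, fun T hT n t ht hmem halt _ _ ↦ h T hT n t ht hmem halt⟩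

/-- **Given the RH-free census [24906], `RH ↔ ScrewSignSparseKV` [24907]** (through the proved glue [24908]
`screwSignSparseGlue_proof` and the certificate above): landing `KinkValleyCensus` converts the gen-1 child from
paper-costume to kernel-costume and changes no strength. -/
theorem riemannHypothesis_iff_screwSignSparseKV_of_census (hC : KinkValleyCensus) :
    Summit.RiemannHypothesis ↔ ScrewSignSparseKV :=
  ⟨screwSignSparseKV_of_riemannHypothesis,
    fun hKV ↦ riemannHypothesis_iff_screwSignSparse.2 (screwSignSparseGlue_proof hC hKV)⟩

/-- Corollary in arrow form: census + kink–valley bound ⟹ RH (= `closes` re-routed through the gen-1 split;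
both hypotheses are OPEN items, the second RH-equivalent given the first). -/
theorem riemannHypothesis_of_census_of_screwSignSparseKV :
    KinkValleyCensus → ScrewSignSparseKV → Summit.RiemannHypothesis :=
  fun hC ↦ (riemannHypothesis_iff_screwSignSparseKV_of_census hC).2

end Summit.RiemannHypothesis.RiemannHypothesis.Theorems.ScrewPolyaSignsResidualIff

end
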